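import Literature.AlgebraicGeometry.Resolution.ArithmeticalThreefoldsLocalDescentKummer
import Literature.AlgebraicGeometry.Resolution.LocAtCentreSubfieldTransport
import Literature.AlgebraicGeometry.Resolution.InvariantFractionField
import Literature.AlgebraicGeometry.Resolution.RegularLocalRingsQuotient
import HarnessLib

/-!
# The Kummer core of tame descent from a STABLE local uniformization ([CoP1] Lemma 9.4, second half)

Topic: `Literature/AlgebraicGeometry/Resolution`. PROOF side of `CossartPiltant2019ReductionP`
(`ArithmeticalThreefoldsLocal.lean`), input (C4). `ArithmeticalThreefoldsLocalDescentKummer.lean`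
reduced (C4) to unramified descent ([CoP1] Prop. 9.3) and the totally ramified KUMMER CORE
`hKummer` of [CoP1] Lemma 9.4: `ζ_ℓ ∈ A ∋ S`, `N = A(θ) | A` Galois of prime degree `ℓ ≠ p`
with inertia group everything, `(LU N) ⇒ (LU A)`. The printed proof (HAL p. 29):

> let `S` be a local uniformization of `W/k` … `S` is stable by `G`, since any conjugate of `S`
> is dominated by `W`, hence equal to `S`. Let `R := S^G` … [the toric modification
> `S[y₁, y₂, y₃]`, `R₁ := S₁^G`] … Thus `S₁^G` is a local uniformization of `V/k`.

Its local-algebra content for a `G`-STABLE model is the theorem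
`exists_fixed_model_isRegularLocalRing` (`TameCyclicToricDescentModels.lean`, every dimension).
This file proves **`hKummer` for every Kummer step admitting a `Gal(N|A)`-STABLE local
uniformization** — i.e. the whole second half of the printed proof GIVEN its first sentence —
by transporting the stable model `S[t] ⊆ O_E`, `t ⊆ N`, into the field `N` itself (where the
generator `σ` of `Gal(N|A)` is an automorphism of order `ℓ`; it has no extension of finite
order to the algebraically closed `E`), over the base `(S[ζ, c, n])_𝔪 ⊆ N^σ = A` (with `c/n`
running through norm-trick representations `b = c/n`, `c, n ∈ S[t]^σ`, of an `Frac(S)`-basis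
`b` of `A`, `InvariantFractionField.lean` — so that the descended model still has fraction
field `A`), and reading the fixed regular model back in `E` (`LocAtCentreSubfieldTransport.lean`).
What remains of (C4) after this file: [CoP1] Prop. 9.3 (unramified descent) and the
STABILISATION `hStable` (a regular model upstairs stable under `Gal(N|A)`), the one sentence of
the printed proof without proof in print.

* `kummerCore_of_stableModel` — PROVED: `hKummer` from a `Gal(N|A)`-stable local uniformization;
* `cossartPiltant2019ReductionP_of_cjs_of_stable` — PROVED:
  `CossartPiltant2019Local → CossartPiltant2019Principalization → CossartJannsenSaito2020General →
  (embedded resolution of surfaces) → (stabilisation) → (Prop. 9.3) → CossartPiltant2019ReductionP`.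

Everything is PROVED; no named facts are introduced.

## Sources

* V. Cossart, O. Piltant, J. Algebra 320 (2008) 1051–1082: Lemma 9.4 and its proof (HAL
  hal-00139124, pp. 28–29). [CossartPiltant2008]
* V. Cossart, O. Piltant, J. Algebra 529 (2019) 268–535 = arXiv:1412.0868, proof of Prop. 4.10
  (arXiv v1: Prop. 4.8, p. 54). [CossartPiltant2019]
-/

noncomputable section

open CategoryTheory AlgebraicGeometry TopologicalSpace IsLocalRing _root_.Polynomial
  _root_.IntermediateField

namespace Literature.AlgebraicGeometry.Resolution

universe u

section Stable

variable {S E : Type u} [CommRing S] [IsRegularLocalRing S] [Field E] [Algebra S E]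

/-- `closure (closure X ∪ Y) = closure (X ∪ Y)`. [folklore] -/
private theorem closure_closure_union' {F : Type u} [Field F] (X Y : Set F) :
    Subring.closure ((Subring.closure X : Set F) ∪ Y) = Subring.closure (X ∪ Y) := by
  apply le_antisymm
  · refine Subring.closure_le.mpr (Set.union_subset ?_ ?_)
    · exact Subring.closure_mono Set.subset_union_left
    · exact fun y hy => Subring.subset_closure (Or.inr hy)
  · refine Subring.closure_mono ?_
    rintro x (hx | hx)
    · exact Or.inl (Subring.subset_closure hx)
    · exact Or.inr hx

set_option maxHeartbeats 400000 in
/-- **The Kummer core of [CoP1] Lemma 9.4 from a stable local uniformization.** Frame: `S`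
universally catenary regular local of residue characteristic `p` in an algebraically closed
valued field `(E, O_E)` dominating it, `E` algebraic over `S`, residue field of `O_E` algebraic
over that of `S`; a prime `ℓ ≠ p`, a primitive `ℓ`-th root of unity `ζ ∈ A ∋ S`, `N = A(θ)`
Galois of degree `ℓ` over `A` with inertia group all of `Gal(N|A)`. Hypothesis `hStable`: a
model `S[t] ⊆ O_E`, `t ⊆ N ⊆ Frac(S)(t)`, regular at the centre and STABLE under `Gal(N|A)`.
Conclusion: `(LU A)`. Proof: in the field `N` with the valuation ring `O_E ∩ N` and a generator
`σ` of `Gal(N|A) = ℤ/ℓ` (residually trivial as `G_T = G`), the base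
`S♭ := (S[ζ, c, n])_𝔪` (`c, n ∈ S[t]^σ` norm-trick numerators and denominators of a basis of
`A` over `Frac S`, `mem_subfieldClosure_fixed_of_apply_eq`) is fixed by `σ`, universally
catenary, contains `ℓ⁻¹` and `μ_ℓ` with `ζ^k − 1` units (`v(ℓ) = 0`); the model `S♭[t]` is
`σ`-stable with local ring `(S[t])_𝔪` (`ζ, c, n` lie in it — `ζ` by normality,
`div_mem_locAtCentre_of_pow_mem`), regular; `exists_fixed_model_isRegularLocalRing` gives
`σ`-fixed `u` with `(S♭[u])_𝔪` regular; read back in `E`, `S[ζ, c, n, u]` is a model of `A`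
(fixed elements lie in `A = N^{Gal}`; its fraction field contains the basis `c/n`) regular at
the centre (`isRegularLocalRing_locAtCentre_map_iff`).
[cite: CossartPiltant2008, proof of Lemma 9.4 (HAL p. 29)] -/
theorem kummerCore_of_stableModel [IsAlgClosed E] [Algebra.IsAlgebraic S E]
    (p : ℕ) (hp : p.Prime) (hSchar : CharP (ResidueField S) p)
    (hSuc : IsUniversallyCatenaryRing S) (hinj : Function.Injective (algebraMap S E))
    (OE : ValuationSubring E) (hSO : ∀ s : S, algebraMap S E s ∈ OE)
    (hdom : ∀ s ∈ maximalIdeal S, OE.valuation (algebraMap S E s) < 1)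
    (hres : ∀ y : OE, ∃ q : S[X], (∃ i, q.coeff i ∉ maximalIdeal S) ∧
      OE.valuation (q.eval₂ (algebraMap S E) y) < 1)
    {ℓ : ℕ} (hℓ : ℓ.Prime) (hℓp : ℓ ≠ p) {ζ : E} (hζ : IsPrimitiveRoot ζ ℓ)
    (A : Subfield E) (hSA : ∀ s : S, algebraMap S E s ∈ A) (hζA : ζ ∈ A) (θ : E)
    (hfin : Module.finrank A (adjoin A ({θ} : Set E)) = ℓ) [IsGalois A (adjoin A ({θ} : Set E))]
    (htop : inertiaGroupIn OE (adjoin A ({θ} : Set E)) = ⊤)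
    (hStable : ∃ t : Finset E, (t : Set E) ⊆ (adjoin A ({θ} : Set E)).toSubfield ∧
      (adjoin A ({θ} : Set E)).toSubfield ≤
        Subfield.closure (Set.range (algebraMap S E) ∪ (t : Set E)) ∧
      ∃ hTO : (Algebra.adjoin S (t : Set E)).toSubring ≤ OE.toSubring,
        IsRegularLocalRing (Localization.AtPrime
          (Ideal.comap (Subring.inclusion hTO) (maximalIdeal OE))) ∧
        ∀ (τ : adjoin A ({θ} : Set E) ≃ₐ[A] adjoin A ({θ} : Set E)) (x : adjoin A ({θ} : Set E)),
          (x : E) ∈ Algebra.adjoin S (t : Set E) →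
          ((τ x : adjoin A ({θ} : Set E)) : E) ∈ Algebra.adjoin S (t : Set E)) :
    ∃ t : Finset E, (t : Set E) ⊆ A ∧
      A ≤ Subfield.closure (Set.range (algebraMap S E) ∪ (t : Set E)) ∧
      ∃ hTO : (Algebra.adjoin S (t : Set E)).toSubring ≤ OE.toSubring,
        IsRegularLocalRing (Localization.AtPrime
          (Ideal.comap (Subring.inclusion hTO) (maximalIdeal OE))) := by
  classical
  obtain ⟨t, htN, hNcl, hTO, hreg, hstab⟩ := hStable
  set N : IntermediateField A E := adjoin A ({θ} : Set E) with hNdef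
  haveI : Fact p.Prime := ⟨hp⟩
  haveI : Fact ℓ.Prime := ⟨hℓ⟩
  have hℓ0 : ℓ ≠ 0 := hℓ.ne_zero
  haveI : NeZero ℓ := ⟨hℓ0⟩
  haveI : FiniteDimensional A N := Module.finite_of_finrank_pos (by rw [hfin]; exact hℓ.pos)
  /- `v(ℓ) = 1`, `v(ζ) = 1`, `v(ζ^k − 1) = 1` -/
  haveI hchar : CharP (ResidueField OE) p :=
    charP_residueField_valuationSubring_of_dominates OE p hSchar hSO hdom
  have hvℓ : OE.valuation (ℓ : E) = 1 := by
    have hres0 : (ℓ : ResidueField OE) ≠ 0 := by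
      intro h0
      have h1 : p ∣ ℓ := (CharP.cast_eq_zero_iff (ResidueField OE) p ℓ).mp h0
      exact hℓp ((Nat.prime_dvd_prime_iff_eq hp hℓ).mp h1).symm
    have hnotmem : (ℓ : OE) ∉ maximalIdeal OE := fun hmem => hres0 (by
      rw [← map_natCast (IsLocalRing.residue OE) ℓ, IsLocalRing.residue_eq_zero_iff]
      exact hmem)
    have h1 : OE.valuation ((ℓ : OE) : E) = 1 := by
      have hle : OE.valuation ((ℓ : OE) : E) ≤ 1 := (OE.valuation_le_one_iff _).mpr (ℓ : OE).2
      have hnlt : ¬ OE.valuation ((ℓ : OE) : E) < 1 := fun hlt =>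
        hnotmem ((ValuationSubring.valuation_lt_one_iff OE _).mpr hlt)
      exact le_antisymm hle (not_lt.mp hnlt)
    rwa [show ((ℓ : OE) : E) = (ℓ : E) from map_natCast OE.subtype ℓ] at h1
  have hvζ : OE.valuation ζ = 1 := by
    have h1 : OE.valuation ζ ^ ℓ = 1 := by rw [← map_pow, hζ.pow_eq_one, map_one]
    rcases pow_eq_one_iff.mp h1 with h | h
    · exact h
    · exact absurd h hℓ0
  have hζO : ζ ∈ OE := (OE.valuation_le_one_iff _).mp hvζ.le
  have hvζk : ∀ k : ℕ, 0 < k → k < ℓ → OE.valuation (ζ ^ k - 1) = 1 := by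
    intro k hk hkℓ
    have hne : ζ ^ k * ζ ≠ ζ := by
      intro h
      apply hζ.pow_ne_one_of_pos_of_lt hk.ne' hkℓ
      have hζ0 : ζ ≠ 0 := hζ.ne_zero hℓ0
      exact mul_right_cancel₀ hζ0 (by rw [h, one_mul])
    have hη : (ζ ^ k) ^ ℓ = 1 := by rw [← pow_mul, mul_comm, pow_mul, hζ.pow_eq_one, one_pow]
    have h := valuation_pow_sub_self_eq_one OE hvℓ hζ.pow_eq_one hη hne
    have h2 : ζ ^ k * ζ - ζ = (ζ ^ k - 1) * ζ := by ring
    rw [h2, map_mul, hvζ, mul_one] at h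
    exact h
  /- the Galois group `Gal(N|A) = ℤ/ℓ`, a non-trivial element `σ₀`, fixed elements lie in `A` -/
  have hcard : Nat.card (N ≃ₐ[A] N) = ℓ := by rw [IsGalois.card_aut_eq_finrank, hfin]
  haveI : Fact (Nat.card (N ≃ₐ[A] N)).Prime := ⟨by rw [hcard]; exact hℓ⟩
  haveI : Finite (N ≃ₐ[A] N) := Nat.finite_of_card_ne_zero (by rw [hcard]; exact hℓ0)
  obtain ⟨σ₀, hσ₀1⟩ : ∃ σ₀ : N ≃ₐ[A] N, σ₀ ≠ 1 := by
    have h1 : 1 < Nat.card (N ≃ₐ[A] N) := by rw [hcard]; exact hℓ.one_lt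
    haveI := (Finite.one_lt_card_iff_nontrivial).mp h1
    exact exists_ne 1
  have hσ₀ℓ : σ₀ ^ ℓ = 1 := by rw [← hcard]; exact pow_card_eq_one'
  have hzp : Subgroup.zpowers σ₀ = ⊤ :=
    ((Subgroup.zpowers σ₀).eq_bot_or_eq_top_of_prime_card).resolve_left
      (by rw [Subgroup.zpowers_eq_bot]; exact hσ₀1)
  have hσ₀pow : ∀ (n : ℕ) (z : N), σ₀ z = z → (σ₀ ^ n) z = z := by
    intro n z hz
    induction n with
    | zero => rfl
    | succ n ih => rw [pow_succ, AlgEquiv.mul_apply, hz, ih]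
  have hfixA : ∀ z : N, σ₀ z = z → (z : E) ∈ A := by
    intro z hz
    have hall : ∀ f : N ≃ₐ[A] N, f z = z := by
      intro f
      have hf : f ∈ Subgroup.zpowers σ₀ := by rw [hzp]; exact Subgroup.mem_top f
      have hf' : f ∈ Submonoid.powers σ₀ :=
        ((isOfFinOrder_of_finite σ₀).mem_powers_iff_mem_zpowers).mpr hf
      obtain ⟨n, rfl⟩ := (Submonoid.mem_powers_iff _ _).mp hf'
      exact hσ₀pow n z hz
    obtain ⟨a, ha⟩ := (IsGalois.mem_range_algebraMap_iff_fixed z).mpr hall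
    rw [← ha]
    exact a.2
  /- inertia: `σ₀` preserves `O_E ∩ N` and is residually trivial -/
  have hσ₀i : σ₀ ∈ inertiaGroupIn OE N := by rw [htop]; exact Subgroup.mem_top _
  obtain ⟨hσ₀O, hσ₀v⟩ := (mem_inertiaGroupIn_iff OE N σ₀).mp hσ₀i
  /- the field `N` with `O′ = O_E ∩ N` and `σ = σ₀` as a ring automorphism -/
  let ι : N →+* E := algebraMap N E
  have hι : ∀ x : N, ι x = (x : E) := fun _ => rfl
  let O' : ValuationSubring N := OE.comap ι
  have hO' : ∀ x : N, x ∈ O' ↔ (x : E) ∈ OE := fun _ => Iff.rfl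
  let σ : N ≃+* N := σ₀.toRingEquiv
  have hσ : ∀ x : N, σ x = σ₀ x := fun _ => rfl
  have hσpow : ∀ (n : ℕ) (x : N), (σ ^ n) x = (σ₀ ^ n) x := by
    intro n
    induction n with
    | zero => intro x; rfl
    | succ n ih =>
      intro x
      rw [pow_succ', RingAut.mul_apply, pow_succ', AlgEquiv.mul_apply, ih]
      rfl
  have hσℓ : σ ^ ℓ = 1 := RingEquiv.ext fun x => by rw [hσpow, hσ₀ℓ]; rfl
  have hσO : ∀ x ∈ O', σ x ∈ O' := fun x hx => (hσ₀O x).mp hx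
  -- the fixed subring of `σ`
  let Fix : Subring N :=
    { carrier := {x | σ x = x}
      mul_mem' := fun {a b} ha hb => by
        change σ (a * b) = a * b; rw [map_mul, ha, hb]
      one_mem' := map_one σ
      add_mem' := fun {a b} ha hb => by
        change σ (a + b) = a + b; rw [map_add, ha, hb]
      zero_mem' := map_zero σ
      neg_mem' := fun {a} ha => by change σ (-a) = -a; rw [map_neg, ha] }
  have hFix : ∀ x : N, x ∈ Fix ↔ σ x = x := fun x => Iff.rfl
  /- the base `S → N`, `ζ ∈ N`, the generators `t` inside `N` -/
  let φ : S →+* N := (algebraMap A N).comp ((algebraMap S E).codRestrict A hSA)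
  have hφ : ∀ s : S, ((φ s : N) : E) = algebraMap S E s := fun _ => rfl
  have hσφ : ∀ s : S, σ (φ s) = φ s := fun s => σ₀.commutes _
  let SF : Subring N := φ.range
  have hSFuc : IsUniversallyCatenaryRing SF :=
    hSuc.of_surjective φ.rangeRestrict φ.rangeRestrict_surjective
  have hζN : ζ ∈ N := N.algebraMap_mem ⟨ζ, hζA⟩
  let ζN : N := ⟨ζ, hζN⟩
  have hσζ : σ ζN = ζN := by
    have h : ζN = algebraMap A N ⟨ζ, hζA⟩ := Subtype.ext rfl
    rw [hσ, h, AlgEquiv.commutes]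
  have htN' : ∀ x ∈ t, x ∈ N := fun x hx => htN (Finset.mem_coe.mpr hx)
  let t₀ : Finset N := t.subtype (· ∈ N)
  have ht₀ : ∀ y : N, y ∈ t₀ ↔ (y : E) ∈ t := fun y => Finset.mem_subtype
  -- models over `S` inside `N` and their images in `E`
  have hmapcl : ∀ X : Finset N, (Subring.closure ((SF : Set N) ∪ ↑X)).map ι =
      (Algebra.adjoin S ((X.image ι : Finset E) : Set E)).toSubring := by
    intro X
    rw [RingHom.map_closure, Algebra.adjoin_eq_ring_closure, Set.image_union]
    congr 1
    ext x
    simp only [Set.mem_union, Set.mem_image, SetLike.mem_coe, Set.mem_range, Finset.coe_image]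
    constructor
    · rintro (⟨y, ⟨s, rfl⟩, rfl⟩ | ⟨y, hy, rfl⟩)
      · exact Or.inl ⟨s, (hφ s).symm⟩
      · exact Or.inr ⟨y, hy, rfl⟩
    · rintro (⟨s, rfl⟩ | ⟨y, hy, rfl⟩)
      · exact Or.inl ⟨φ s, ⟨s, rfl⟩, hφ s⟩
      · exact Or.inr ⟨y, hy, rfl⟩
  have ht₀im : t₀.image ι = t := by
    ext x
    simp only [Finset.mem_image]
    constructor
    · rintro ⟨y, hy, rfl⟩
      exact (ht₀ y).mp hy
    · intro hx
      exact ⟨⟨x, htN' x hx⟩, (ht₀ _).mpr hx, rfl⟩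
  set T₀N : Subring N := Subring.closure ((SF : Set N) ∪ ↑t₀) with hT₀N
  have hT₀map : T₀N.map ι = (Algebra.adjoin S (t : Set E)).toSubring := by
    rw [hT₀N, hmapcl t₀, ht₀im]
  have hmemT₀ : ∀ y : N, y ∈ T₀N ↔ (y : E) ∈ Algebra.adjoin S (t : Set E) := by
    intro y
    constructor
    · intro hy
      have h : ι y ∈ (Algebra.adjoin S (t : Set E)).toSubring := by
        rw [← hT₀map]; exact ⟨y, hy, rfl⟩
      exact h
    · intro hy
      have h : ι y ∈ T₀N.map ι := by rw [hT₀map]; exact hy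
      obtain ⟨y', hy', hyy'⟩ := h
      have : y' = y := (algebraMap N E).injective hyy'
      rw [← this]
      exact hy'
  have hT₀O' : T₀N ≤ O'.toSubring := fun y hy => (hO' y).mpr (hTO ((hmemT₀ y).mp hy))
  have hσT₀N : ∀ y ∈ T₀N, σ y ∈ T₀N := fun y hy =>
    (hmemT₀ _).mpr (hstab σ₀ y ((hmemT₀ y).mp hy))
  -- the local ring of `S[t]` read in `N` is regular
  have hregN : IsRegularLocalRing (locAtCentre T₀N O') := by
    rw [isRegularLocalRing_locAtCentre_map_iff OE ι T₀N, hT₀map]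
    exact (isRegularLocalRing_locAtCentre_iff hTO).mpr hreg
  -- every element of `N` is a fraction of elements of `S[t]`
  have hfracN : ∀ y : N, y ∈ Subfield.closure (T₀N : Set N) := by
    intro y
    have hle : Subfield.closure (Set.range (algebraMap S E) ∪ (t : Set E)) ≤
        (Subfield.closure (T₀N : Set N)).map ι := by
      rw [Subfield.closure_le]
      rintro x (⟨s, rfl⟩ | hx)
      · exact ⟨φ s, Subfield.subset_closure (Subring.subset_closure (Or.inl ⟨s, rfl⟩)), hφ s⟩
      · exact ⟨⟨x, htN' x hx⟩, Subfield.subset_closure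
          (Subring.subset_closure (Or.inr (Finset.mem_coe.mpr ((ht₀ _).mpr hx)))), rfl⟩
    obtain ⟨y', hy', hyy'⟩ := hle (hNcl y.2)
    have : y' = y := (algebraMap N E).injective hyy'
    rw [← this]
    exact hy'
  /- an `Frac S`-basis of `A` and its norm-trick representatives `b = c/n`, `c, n ∈ S[t]^σ` -/
  let F₀ : Subfield E := Subfield.closure (Set.range (algebraMap S E))
  have hSF₀ : ∀ s : S, algebraMap S E s ∈ F₀ := fun s => Subfield.subset_closure ⟨s, rfl⟩
  have hF₀A : F₀ ≤ A := Subfield.closure_le.mpr (by rintro _ ⟨s, rfl⟩; exact hSA s)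
  have hint : ∀ x : E, IsIntegral F₀ x := by
    intro x
    obtain ⟨q, hq0, hqx⟩ := Algebra.IsAlgebraic.isAlgebraic (R := S) x
    let φ₀ : S →+* F₀ := (algebraMap S E).codRestrict F₀ hSF₀
    have hφ₀ : Function.Injective φ₀ := fun a b h => hinj (congrArg Subtype.val h)
    have hq' : q.map φ₀ ≠ 0 := (Polynomial.map_ne_zero_iff hφ₀).mpr hq0
    have hcomp : (algebraMap F₀ E).comp φ₀ = algebraMap S E := RingHom.ext fun _ => rfl
    have haeval : aeval x (q.map φ₀) = 0 := by
      rw [aeval_def, eval₂_map, hcomp]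
      exact hqx
    exact isAlgebraic_iff_isIntegral.mp ⟨q.map φ₀, hq', haeval⟩
  -- `A` is finite over `F₀ = Frac S`: an intermediate field of `F₀(t) | F₀`
  let K₁ : IntermediateField F₀ E := IntermediateField.adjoin F₀ (t : Set E)
  haveI hK₁fd : FiniteDimensional F₀ K₁ :=
    IntermediateField.finiteDimensional_adjoin fun x _ => hint x
  have hrangeF₀ : Set.range (algebraMap F₀ E) = (F₀ : Set E) := by
    ext z
    constructor
    · rintro ⟨w, rfl⟩
      exact w.2
    · intro hz
      exact ⟨⟨z, hz⟩, rfl⟩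
  have hK₁ : K₁.toSubfield = Subfield.closure (Set.range (algebraMap S E) ∪ (t : Set E)) := by
    change (IntermediateField.adjoin F₀ (t : Set E)).toSubfield = _
    rw [IntermediateField.adjoin_toSubfield, hrangeF₀]
    apply le_antisymm
    · refine Subfield.closure_le.mpr ?_
      rintro z (hz | hz)
      · exact Subfield.closure_mono Set.subset_union_left hz
      · exact Subfield.subset_closure (Set.mem_union_right _ hz)
    · refine Subfield.closure_le.mpr ?_
      rintro z (⟨w, rfl⟩ | hz)
      · exact Subfield.subset_closure (Set.mem_union_left _ (hSF₀ w))
      · exact Subfield.subset_closure (Set.mem_union_right _ hz)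
  let A' : IntermediateField F₀ E := A.toIntermediateField fun c => hF₀A c.2
  have hA'K₁ : A' ≤ K₁ := by
    intro x hx
    have hxA : x ∈ A := hx
    have hxN : x ∈ N.toSubfield := N.algebraMap_mem ⟨x, hxA⟩
    show x ∈ K₁.toSubfield
    rw [hK₁]
    exact hNcl hxN
  haveI hA'fd : FiniteDimensional F₀ A' :=
    Module.Finite.of_injective (IntermediateField.inclusion hA'K₁).toLinearMap
      (IntermediateField.inclusion_injective hA'K₁)
  let bA := Module.finBasis F₀ A'
  let g : Finset E := Finset.univ.image fun i => ((bA i : A') : E)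
  have hgA : ∀ b ∈ g, b ∈ A := by
    intro b hb
    obtain ⟨i, -, rfl⟩ := Finset.mem_image.mp hb
    exact (bA i).2
  have hAspan : ∀ a ∈ A, a ∈ Subfield.closure ((F₀ : Set E) ∪ (g : Set E)) := by
    intro a ha
    have hrepr := bA.sum_repr ⟨a, ha⟩
    have h : ((∑ i, (bA.repr ⟨a, ha⟩ i) • bA i : A') : E) = a := congrArg Subtype.val hrepr
    rw [← h]
    push_cast
    refine sum_mem fun i _ => ?_
    rw [Subfield.smul_def, smul_eq_mul]
    exact mul_mem (Subfield.subset_closure (Or.inl (bA.repr ⟨a, ha⟩ i).2))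
      (Subfield.subset_closure (Or.inr (Finset.mem_coe.mpr
        (Finset.mem_image.mpr ⟨i, Finset.mem_univ i, rfl⟩))))
  -- norm trick: `b = c/n` with `c, n ∈ S[t]^σ`
  have hnorm : ∀ b ∈ g, ∃ c n : N, c ∈ T₀N ∧ σ c = c ∧ n ∈ T₀N ∧ σ n = n ∧
      ((c : E) / n = b) := by
    intro b hb
    have hbA : b ∈ A := hgA b hb
    let bN : N := ⟨b, N.algebraMap_mem ⟨b, hbA⟩⟩
    have hσb : σ bN = bN := by
      have h : bN = algebraMap A N ⟨b, hbA⟩ := Subtype.ext rfl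
      rw [hσ, h, AlgEquiv.commutes]
    have hmem := mem_subfieldClosure_fixed_of_apply_eq σ hℓ0 hσℓ T₀N hσT₀N (hfracN bN) hσb
    obtain ⟨c, hc, n, hn, hcn⟩ := Subfield.mem_closure_iff.mp hmem
    have hW : Subring.closure {x : N | x ∈ T₀N ∧ σ x = x} ≤ T₀N ⊓ Fix :=
      Subring.closure_le.mpr fun x hx => ⟨hx.1, hx.2⟩
    refine ⟨c, n, (hW hc).1, (hW hc).2, (hW hn).1, (hW hn).2, ?_⟩
    have := congrArg (fun z : N => (z : E)) hcn
    simpa using this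
  choose! cf nf hcf using hnorm
  let G : Finset N := g.image cf ∪ g.image nf
  have hG : ∀ y ∈ G, y ∈ T₀N ∧ σ y = y := by
    intro y hy
    rcases Finset.mem_union.mp hy with hy | hy
    · obtain ⟨b, hb, rfl⟩ := Finset.mem_image.mp hy
      exact ⟨(hcf b hb).1, (hcf b hb).2.1⟩
    · obtain ⟨b, hb, rfl⟩ := Finset.mem_image.mp hy
      exact ⟨(hcf b hb).2.2.1, (hcf b hb).2.2.2.1⟩
  /- the base `S♭ = (S[ζ, c, n])_𝔪 ⊆ N` -/
  let C : Subring N := Subring.closure ((SF : Set N) ∪ ↑(insert ζN G))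
  have hSFO' : ∀ y ∈ SF, y ∈ O' := by
    rintro _ ⟨s, rfl⟩
    exact (hO' _).mpr (hSO s)
  have hSFT₀ : SF ≤ T₀N := fun y hy => Subring.subset_closure (Or.inl hy)
  have hζO' : ζN ∈ O' := (hO' _).mpr hζO
  have hCO' : C ≤ O'.toSubring := by
    refine Subring.closure_le.mpr (Set.union_subset hSFO' ?_)
    intro y hy
    rcases Finset.mem_insert.mp (Finset.mem_coe.mp hy) with rfl | hy
    · exact hζO'
    · exact hT₀O' (hG y hy).1
  have hσC : ∀ y ∈ C, σ y = y := by
    intro y hy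
    refine (Subring.closure_le (t := Fix)).mpr ?_ hy
    rintro z (⟨s, rfl⟩ | hz)
    · exact hσφ s
    · rcases Finset.mem_insert.mp (Finset.mem_coe.mp hz) with rfl | hz
      · exact hσζ
      · exact (hG z hz).2
  set Sb : Subring N := locAtCentre C O' with hSb
  have hSbO : Sb ≤ O'.toSubring := locAtCentre_le hCO'
  have hσSb : ∀ y ∈ Sb, σ y = y := by
    intro y hy
    obtain ⟨a, ha, b, hb, -, rfl⟩ := mem_locAtCentre_iff.mp hy
    rw [map_div₀, hσC a ha, hσC b hb]
  have hSbuc : IsUniversallyCatenaryRing Sb :=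
    isUniversallyCatenaryRing_locAtCentre_closure O' SF hSFuc (insert ζN G) hCO'
  have hSFSb : SF ≤ Sb := fun y hy => le_locAtCentre C O' (Subring.subset_closure (Or.inl hy))
  have hζSb : ζN ∈ Sb :=
    le_locAtCentre C O' (Subring.subset_closure (Or.inr (Finset.mem_coe.mpr
      (Finset.mem_insert_self _ _))))
  have hGSb : ∀ y ∈ G, y ∈ Sb := fun y hy =>
    le_locAtCentre C O' (Subring.subset_closure (Or.inr (Finset.mem_coe.mpr
      (Finset.mem_insert_of_mem hy))))
  -- units of `S♭`: `ℓ` and `ζ^k − 1`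
  have hunitSb : ∀ y : Sb, OE.valuation ((y : N) : E) = 1 → IsUnit y := fun y hy =>
    isUnit_locAtCentre_of_valuation_eq_one O' hCO' y
      ((valuation_comap_ringHom_eq_one_iff OE ι _).mpr hy)
  have hℓu : IsUnit ((ℓ : Sb)) := by
    refine hunitSb _ ?_
    have h : (((ℓ : Sb) : N) : E) = (ℓ : E) := by norm_cast
    rw [h]
    exact hvℓ
  have hζℓN : ζN ^ ℓ = 1 := Subtype.ext (by push_cast; exact hζ.pow_eq_one)
  have hζu : ∀ k : ℕ, 0 < k → k < ℓ → IsUnit ((⟨ζN, hζSb⟩ : Sb) ^ k - 1) := by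
    intro k hk hkℓ
    refine hunitSb _ ?_
    have h : ((((⟨ζN, hζSb⟩ : Sb) ^ k - 1 : Sb) : N) : E) = ζ ^ k - 1 := by
      push_cast
      rfl
    rw [h]
    exact hvζk k hk hkℓ
  /- the `σ`-stable model `S♭[t]` upstairs, with local ring `(S[t])_𝔪` -/
  set T₁ : Subring N := Subring.closure ((Sb : Set N) ∪ ↑t₀) with hT₁
  have hT₀T₁ : T₀N ≤ T₁ := Subring.closure_mono (Set.union_subset_union_left _ hSFSb)
  have hT₁O : T₁ ≤ O'.toSubring :=
    Subring.closure_le.mpr (Set.union_subset hSbO fun y hy => hT₀O' (Subring.subset_closure (Or.inr hy)))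
  have hσT₁ : ∀ y ∈ T₁, σ y ∈ T₁ := by
    have hsub : T₁ ≤ T₁.comap σ.toRingHom := by
      rw [hT₁]
      refine Subring.closure_le.mpr ?_
      rintro y (hy | hy)
      · refine Subring.mem_comap.mpr ?_
        change σ y ∈ Subring.closure ((Sb : Set N) ∪ ↑t₀)
        rw [hσSb y hy]
        exact Subring.subset_closure (Or.inl hy)
      · refine Subring.mem_comap.mpr ?_
        change σ y ∈ Subring.closure ((Sb : Set N) ∪ ↑t₀)
        exact hT₀T₁ (hσT₀N y (Subring.subset_closure (Or.inr hy)))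
    exact fun y hy => hsub hy
  -- `ζ ∈ (S[t])_𝔪` by normality, hence `C ⊆ (S[t])_𝔪` and `(S♭[t])_𝔪 = (S[t])_𝔪`
  have hζL : ζN ∈ locAtCentre T₀N O' := by
    obtain ⟨x, hx, y, hy, hxy⟩ := Subfield.mem_closure_iff.mp (hfracN ζN)
    rw [Subring.closure_eq] at hx hy
    rw [← hxy]
    refine div_mem_locAtCentre_of_pow_mem O' hregN (le_locAtCentre _ O' hx)
      (le_locAtCentre _ O' hy) hℓ0 ?_
    rw [hxy, hζℓN]
    exact Subring.one_mem _
  have hCL : C ≤ locAtCentre T₀N O' := by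
    refine Subring.closure_le.mpr (Set.union_subset (fun y hy => le_locAtCentre _ O' (hSFT₀ hy)) ?_)
    intro y hy
    rcases Finset.mem_insert.mp (Finset.mem_coe.mp hy) with rfl | hy
    · exact hζL
    · exact le_locAtCentre _ O' (hG y hy).1
  have hlocT₁ : locAtCentre T₁ O' = locAtCentre T₀N O' := by
    have h1 : locAtCentre T₁ O' = locAtCentre (Subring.closure ((C : Set N) ∪ ↑t₀)) O' := by
      rw [hT₁, hSb, locAtCentre_closure_locAtCentre_union_eq O' C]
    rw [h1]
    apply le_antisymm
    · have h2 : Subring.closure ((C : Set N) ∪ ↑t₀) ≤ locAtCentre T₀N O' :=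
        Subring.closure_le.mpr (Set.union_subset hCL fun y hy =>
          le_locAtCentre _ O' (Subring.subset_closure (Or.inr hy)))
      exact (locAtCentre_mono O' h2).trans (locAtCentre_locAtCentre _ O').le
    · refine locAtCentre_mono O' (Subring.closure_mono (Set.union_subset_union_left _ ?_))
      exact fun y hy => Subring.subset_closure (Or.inl hy)
  have hBreg : IsRegularLocalRing (locAtCentre T₁ O') := by rw [hlocT₁]; exact hregN
  -- dimension, residual triviality, residual algebraicity
  haveI := hBreg
  obtain ⟨d, hd⟩ := exists_nat_cast_eq_ringKrullDim (R := locAtCentre T₁ O')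
  have hresσ : ∀ b ∈ locAtCentre T₁ O', O'.valuation (σ b - b) < 1 := by
    intro b hb
    have hbO : (b : E) ∈ OE := (hO' b).mp (locAtCentre_le hT₁O hb)
    rw [valuation_comap_lt_one_iff OE ι, map_sub]
    exact hσ₀v b hbO
  have halg : ∀ z : O', ∃ q : Polynomial Sb, (∃ i, IsUnit (q.coeff i)) ∧
      O'.valuation (Polynomial.aeval (z : N) q) < 1 := by
    intro z
    obtain ⟨q, ⟨i, hi⟩, hq⟩ := hres ⟨((z : N) : E), (hO' _).mp z.2⟩
    let ψ : S →+* Sb := (Subring.inclusion hSFSb).comp φ.rangeRestrict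
    have hψ : ∀ s : S, (((ψ s : Sb) : N) : E) = algebraMap S E s := fun _ => rfl
    have hunit : IsUnit (q.coeff i) := by
      by_contra h
      exact hi ((IsLocalRing.mem_maximalIdeal _).mpr (mem_nonunits_iff.mpr h))
    refine ⟨q.map ψ, ⟨i, ?_⟩, ?_⟩
    · rw [Polynomial.coeff_map]
      exact hunit.map ψ
    · rw [valuation_comap_lt_one_iff OE ι, Polynomial.aeval_def, Polynomial.eval₂_map,
        Polynomial.hom_eval₂]
      have hcomp : ι.comp ((algebraMap Sb N).comp ψ) = algebraMap S E := RingHom.ext fun s => hψ s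
      rw [hcomp]
      exact hq
  /- the toric descent step -/
  obtain ⟨u, huσ, huO, hureg⟩ := exists_fixed_model_isRegularLocalRing O' σ hσO Sb hσSb hSbuc
    t₀ hT₁O hσT₁ hBreg hd hresσ halg hℓ0 hσℓ hℓu ζN hζSb hζℓN hζu
  /- reading the fixed model `S[ζ, c, n, u]` back in `E` -/
  let tN : Finset N := insert ζN G ∪ u
  have htNfix : ∀ y ∈ tN, σ y = y := by
    intro y hy
    rcases Finset.mem_union.mp hy with hy | hy
    · rcases Finset.mem_insert.mp hy with rfl | hy
      · exact hσζ
      · exact (hG y hy).2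
    · exact huσ y hy
  have htNO : ∀ y ∈ tN, y ∈ O' := by
    intro y hy
    rcases Finset.mem_union.mp hy with hy | hy
    · rcases Finset.mem_insert.mp hy with rfl | hy
      · exact hζO'
      · exact hT₀O' (hG y hy).1
    · exact huO (Subring.subset_closure (Or.inr hy))
  have hlocu : locAtCentre (Subring.closure ((Sb : Set N) ∪ ↑u)) O' =
      locAtCentre (Subring.closure ((SF : Set N) ∪ ↑tN)) O' := by
    rw [hSb, locAtCentre_closure_locAtCentre_union_eq O' C, closure_closure_union',
      Set.union_assoc, ← Finset.coe_union]
  let tE : Finset E := tN.image ι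
  have htE : (Subring.closure ((SF : Set N) ∪ ↑tN)).map ι = (Algebra.adjoin S (tE : Set E)).toSubring :=
    hmapcl tN
  refine ⟨tE, ?_, ?_, ?_⟩
  · -- `S[ζ, c, n, u] ⊆ A`
    intro x hx
    obtain ⟨y, hy, rfl⟩ := Finset.mem_image.mp (Finset.mem_coe.mp hx)
    exact hfixA y (htNfix y hy)
  · -- `A ⊆ Frac S[ζ, c, n, u]`
    intro a ha
    refine (Subfield.closure_le.mpr ?_) (hAspan a ha)
    rintro x (hx | hx)
    · exact Subfield.closure_mono Set.subset_union_left hx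
    · have hb : x ∈ g := Finset.mem_coe.mp hx
      rw [← (hcf x hb).2.2.2.2]
      refine div_mem (Subfield.subset_closure (Or.inr ?_)) (Subfield.subset_closure (Or.inr ?_))
      · exact Finset.mem_coe.mpr (Finset.mem_image.mpr ⟨cf x, Finset.mem_union_left _
          (Finset.mem_insert_of_mem (Finset.mem_union_left _ (Finset.mem_image_of_mem _ hb))), rfl⟩)
      · exact Finset.mem_coe.mpr (Finset.mem_image.mpr ⟨nf x, Finset.mem_union_left _
          (Finset.mem_insert_of_mem (Finset.mem_union_right _ (Finset.mem_image_of_mem _ hb))), rfl⟩)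
  · -- `S[ζ, c, n, u] ⊆ O_E`, regular at the centre
    have hTOE : (Algebra.adjoin S (tE : Set E)).toSubring ≤ OE.toSubring := by
      rw [← htE]
      rintro _ ⟨y, hy, rfl⟩
      have hyO : y ∈ O' := (Subring.closure_le.mpr (Set.union_subset hSFO' fun z hz => htNO z hz)) hy
      exact (hO' y).mp hyO
    refine ⟨hTOE, (isRegularLocalRing_locAtCentre_iff hTOE).mp ?_⟩
    rw [← htE, ← isRegularLocalRing_locAtCentre_map_iff OE ι, ← hlocu]
    exact hureg

end Stable

/-! ## The reduction with (C4) reduced to unramified descent and stabilisation -/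

/-- **Cossart–Piltant 2019, Prop. 4.10 from Thm. 1.5, principalization, resolution of excellent
surfaces (embedded and non-embedded), unramified descent and STABILISATION of local
uniformizations in totally ramified Kummer steps**: `cossartPiltant2019ReductionP_of_cjs_of_kummer`
with its Kummer core discharged by `kummerCore_of_stableModel`. The remaining analytic inputs
of the printed reduction `Thm. 1.5 ⇒ Thm. 1.1`, besides the local theorem, principalization
(Prop. 4.4) and resolution of surfaces (CJS 2020 Thm. 1.2, Cor. 1.5), are now [CoP1] Prop. 9.3
(`hUnram`, unramified descent) and `hStab`: in a totally ramified Kummer step `N = A(θ) | A` of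
prime degree `ℓ ≠ p` (`ζ_ℓ ∈ A`), a local uniformization of the valuation on `N` may be
replaced by one STABLE under `Gal(N|A)` — the sentence "`S` is stable by `G`, since any
conjugate of `S` is dominated by `W`, hence equal to `S`" of the printed proof of [CoP1]
Lemma 9.4 (HAL p. 29), for rank-one valuations of an algebraically closed valued field
dominating the complete regular local base `S` with algebraic residue field extension.
[cite: CossartPiltant2019, Props. 4.3, 4.4 and proof of Prop. 4.10 (arXiv v1: Props. 4.2, 4.3, 4.8, pp. 50–54)]
[cite: CossartPiltant2008, Lemma 9.4, Prop. 9.3, Prop. 9.5 (HAL pp. 26–30)]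
[cite: CossartJannsenSaito2020, Thm. 1.2, Cor. 1.5] -/
theorem cossartPiltant2019ReductionP_of_cjs_of_stable
    (hloc : CossartPiltant2019Local.{u}) (h44 : CossartPiltant2019Principalization.{u})
    (hCJS : CossartJannsenSaito2020General.{u})
    (hEmb : ∀ (Z : Scheme.{u}) [IsIntegral Z] [IsNoetherian Z], Scheme.IsRegular Z →
      Scheme.IsExcellent Z → ∀ (X : Set Z), IsClosed X → X ≠ Set.univ → topologicalKrullDim X ≤ 2 →
        ∃ (Z' : Scheme.{u}) (π : Z' ⟶ Z), IsProper π ∧ Function.Surjective π.base ∧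
          (∃ U : Z.Opens, (U : Set Z) = Xᶜ ∧ IsIso (π ∣_ U)) ∧
          IsStrictNormalCrossingsDivisor Z' (π.base ⁻¹' X))
    (hStab :
      ∀ (p : ℕ), p.Prime →
      ∀ (S : Type u) [CommRing S] [IsDomain S] [IsRegularLocalRing S],
        IsExcellentRing S → ringKrullDim S = 3 → CharP (ResidueField S) p →
        IsAdicComplete (maximalIdeal S) S →
      ∀ (E : Type u) [Field E] [Algebra S E], Function.Injective (algebraMap S E) →
        IsAlgClosed E → Algebra.IsAlgebraic S E →
      ∀ (OE : ValuationSubring E), (∀ s : S, algebraMap S E s ∈ OE) →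
        (∀ s ∈ maximalIdeal S, OE.valuation (algebraMap S E s) < 1) →
        (∀ y : OE, ∃ q : S[X], (∃ i, q.coeff i ∉ maximalIdeal S) ∧
          OE.valuation (q.eval₂ (algebraMap S E) y) < 1) →
      Nonempty OE.valuation.RankOne →
      ∀ (ℓ : ℕ), ℓ.Prime → ℓ ≠ p → ∀ (ζ : E), IsPrimitiveRoot ζ ℓ →
      ∀ (A : Subfield E), (∀ s : S, algebraMap S E s ∈ A) → ζ ∈ A →
      ∀ (θ : E), θ ∉ A → θ ^ ℓ ∈ A → OE.valuation θ ≤ 1 →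
        Module.finrank A (adjoin A ({θ} : Set E)) = ℓ → IsGalois A (adjoin A ({θ} : Set E)) →
        inertiaGroupIn OE (adjoin A ({θ} : Set E)) = ⊤ →
        (∃ t : Finset E, (t : Set E) ⊆ (adjoin A ({θ} : Set E)).toSubfield ∧
          (adjoin A ({θ} : Set E)).toSubfield ≤
            Subfield.closure (Set.range (algebraMap S E) ∪ (t : Set E)) ∧
          ∃ hTO : (Algebra.adjoin S (t : Set E)).toSubring ≤ OE.toSubring,
            IsRegularLocalRing (Localization.AtPrime
              (Ideal.comap (Subring.inclusion hTO) (maximalIdeal OE)))) →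
        (∃ t : Finset E, (t : Set E) ⊆ (adjoin A ({θ} : Set E)).toSubfield ∧
          (adjoin A ({θ} : Set E)).toSubfield ≤
            Subfield.closure (Set.range (algebraMap S E) ∪ (t : Set E)) ∧
          ∃ hTO : (Algebra.adjoin S (t : Set E)).toSubring ≤ OE.toSubring,
            IsRegularLocalRing (Localization.AtPrime
              (Ideal.comap (Subring.inclusion hTO) (maximalIdeal OE))) ∧
            ∀ (τ : adjoin A ({θ} : Set E) ≃ₐ[A] adjoin A ({θ} : Set E))
              (x : adjoin A ({θ} : Set E)), (x : E) ∈ Algebra.adjoin S (t : Set E) →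
              ((τ x : adjoin A ({θ} : Set E)) : E) ∈ Algebra.adjoin S (t : Set E)))
    (hUnram :
      ∀ (p : ℕ), p.Prime →
      ∀ (S : Type u) [CommRing S] [IsDomain S] [IsRegularLocalRing S],
        IsExcellentRing S → ringKrullDim S = 3 → CharP (ResidueField S) p →
        IsAdicComplete (maximalIdeal S) S →
      ∀ (E : Type u) [Field E] [Algebra S E], Function.Injective (algebraMap S E) →
        IsAlgClosed E → Algebra.IsAlgebraic S E →
      ∀ (OE : ValuationSubring E), (∀ s : S, algebraMap S E s ∈ OE) →
        (∀ s ∈ maximalIdeal S, OE.valuation (algebraMap S E s) < 1) →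
        (∀ y : OE, ∃ q : S[X], (∃ i, q.coeff i ∉ maximalIdeal S) ∧
          OE.valuation (q.eval₂ (algebraMap S E) y) < 1) →
      Nonempty OE.valuation.RankOne →
      ∀ (M : Subfield E), (∀ s : S, algebraMap S E s ∈ M) →
      ∀ (N : IntermediateField M E) [FiniteDimensional M N] [IsGalois M N] (K' : Subfield E),
        M ≤ K' → K' ≤ (lift (fixedField (inertiaGroupIn OE N))).toSubfield →
        (∃ t : Finset E, (t : Set E) ⊆ K' ∧
          K' ≤ Subfield.closure (Set.range (algebraMap S E) ∪ (t : Set E)) ∧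
          ∃ hTO : (Algebra.adjoin S (t : Set E)).toSubring ≤ OE.toSubring,
            IsRegularLocalRing (Localization.AtPrime
              (Ideal.comap (Subring.inclusion hTO) (maximalIdeal OE)))) →
        (∃ t : Finset E, (t : Set E) ⊆ M ∧
          M ≤ Subfield.closure (Set.range (algebraMap S E) ∪ (t : Set E)) ∧
          ∃ hTO : (Algebra.adjoin S (t : Set E)).toSubring ≤ OE.toSubring,
            IsRegularLocalRing (Localization.AtPrime
              (Ideal.comap (Subring.inclusion hTO) (maximalIdeal OE))))) :
    CossartPiltant2019ReductionP.{u} :=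
  cossartPiltant2019ReductionP_of_cjs_of_kummer hloc h44 hCJS hEmb
    (fun p hp S _ _ _ hS hSdim hSchar hScomp E _ _ hinj hE halg OE hSO hdom hres hrk ℓ hℓ hℓp ζ hζ A
        hSA hζA θ hθA hθℓ hvθ hfin hgal htop hLU => by
      haveI := hE
      haveI := halg
      haveI := hgal
      exact kummerCore_of_stableModel p hp hSchar hS.isUniversallyCatenaryRing hinj OE hSO hdom hres
        hℓ hℓp hζ A hSA hζA θ hfin htop
        (hStab p hp S hS hSdim hSchar hScomp E hinj hE halg OE hSO hdom hres hrk ℓ hℓ hℓp ζ hζ A hSA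
          hζA θ hθA hθℓ hvθ hfin hgal htop hLU))
    hUnram

end Literature.AlgebraicGeometry.Resolution

end
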